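import Mathlib
import Literature.Analysis.PDE.NearInverseSquareFarPowerFacts
import Literature.Analysis.PDE.NearInverseSquareFarLadderData
import Literature.Analysis.PDE.Wave1DEnergySeminormSum
import Literature.Analysis.PDE.Wave1DFarSolutionSpace

/-!
# From per-power approximation of the exact far kernel data to `happroxK`

Analysis/PDE support file (everything proved). Fix `n` and the smooth `ι = 1/x` on `[½,∞)`. The
exact kernel data of the far channel estimate are spanned by `(ι^{n−2k}, 0)` (`k ≤ n/2`) and
`(0, ι^{n−2k})` (`k < (n+1)/2`) (`InverseSquareLadderMonomials`). If true kernel elements `Bp k`,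
`Bv k` approximate these directions in the `W`-energy seminorm on `(1,∞)` to RELATIVE accuracy
`δ₀ = δ₀(n, ι) > 0`, then the glued family satisfies hypothesis `hK` of
`NearInverseSquareFarUnit.unitFarChannel_of_kernelFamily`, in particular `happroxK` with factor `½`
(`kernelFamily_of_powerFamily`). Ingredients: the power representation of the ladder-Taylor data,
the triangle inequality of the energy seminorm for finite sums (`Wave1DEnergySeminormSum`), and the
coefficient bounds `exists_coeffBound_position/velocity` (`NearInverseSquareFarKernelData`) for
`n ≥ 1`; `n = 0` is one-dimensional. Route PhotonSphereChannels, `FixedModeChannels`, far side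
(stmt-FinalStateConjecture-10048). Folklore.
-/

noncomputable section

namespace Literature.Analysis.PDE

open Set Filter MeasureTheory Finset Literature.Analysis.ODE Literature.Analysis.Approximation
  Literature.Analysis.Calculus
open scoped _root_.Topology

variable {ι : ℝ → ℝ}

/-- **Gluing a per-power true kernel family into hypothesis `hK` of `unitFarChannel_of_kernelFamily`.**
There is `δ₀ = δ₀(ι, n) > 0` such that for every near-inverse-square `W` (`ε ≤ ¼`) and all global `C²`
kernel elements `Bp k`, `Bv k` (solving on `{x ≥ 1}`, finite `W`-energy data on `(1,∞)`, far energy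
`→ 0` at `±∞`, `t`-polynomial on `{x > 1+|t|}`) whose data are `δ₀`-relatively close in the energy
seminorm to `(ι^{n−2k}, 0)` (`k ≤ n/2`) resp. `(0, ι^{n−2k})` (`k < (n+1)/2`), the glued family
satisfies `hK`, in particular `happroxK` with factor `½`. [folklore] -/
theorem kernelFamily_of_powerFamily (hι : ContDiff ℝ (⊤ : ℕ∞) ι)
    (hιeq : ∀ x : ℝ, 1 / 2 ≤ x → ι x = x⁻¹) (n : ℕ) :
    ∃ δ₀ : ℝ, 0 < δ₀ ∧ ∀ (W : ℝ → ℝ), Continuous W → (∀ x, 0 ≤ W x) → ∀ ε : ℝ, 0 ≤ ε → ε ≤ 1 / 4 →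
      (∀ x : ℝ, 1 / 2 ≤ x → |W x - (n : ℝ) * ((n : ℝ) + 1) / x ^ 2| ≤ ε * x ^ (-(5 : ℝ) / 2)) →
      ∀ (Bp Bv : ℕ → ℝ → ℝ → ℝ),
      (∀ k, ContDiff ℝ 2 (Function.uncurry (Bp k))) →
      (∀ k, ContDiff ℝ 2 (Function.uncurry (Bv k))) →
      (∀ k t x, 1 ≤ x →
        iteratedDeriv 2 (fun τ => Bp k τ x) t - iteratedDeriv 2 (Bp k t) x + W x * Bp k t x = 0) →
      (∀ k t x, 1 ≤ x →
        iteratedDeriv 2 (fun τ => Bv k τ x) t - iteratedDeriv 2 (Bv k t) x + W x * Bv k t x = 0) →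
      (∀ k, IntegrableOn (fun x => deriv (fun τ => Bp k τ x) 0 ^ 2 + deriv (Bp k 0) x ^ 2
        + W x * Bp k 0 x ^ 2) (Ioi 1)) →
      (∀ k, IntegrableOn (fun x => deriv (fun τ => Bv k τ x) 0 ^ 2 + deriv (Bv k 0) x ^ 2
        + W x * Bv k 0 x ^ 2) (Ioi 1)) →
      (∀ k, Tendsto (fun t => ∫ x in Ioi (1 + |t|), (deriv (fun τ => Bp k τ x) t ^ 2
        + deriv (Bp k t) x ^ 2 + W x * Bp k t x ^ 2)) atTop (𝓝 0)) →
      (∀ k, Tendsto (fun t => ∫ x in Ioi (1 + |t|), (deriv (fun τ => Bp k τ x) t ^ 2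
        + deriv (Bp k t) x ^ 2 + W x * Bp k t x ^ 2)) atBot (𝓝 0)) →
      (∀ k, Tendsto (fun t => ∫ x in Ioi (1 + |t|), (deriv (fun τ => Bv k τ x) t ^ 2
        + deriv (Bv k t) x ^ 2 + W x * Bv k t x ^ 2)) atTop (𝓝 0)) →
      (∀ k, Tendsto (fun t => ∫ x in Ioi (1 + |t|), (deriv (fun τ => Bv k τ x) t ^ 2
        + deriv (Bv k t) x ^ 2 + W x * Bv k t x ^ 2)) atBot (𝓝 0)) →
      (∀ k, ∃ (N : ℕ) (a : ℕ → ℝ → ℝ), ∀ z : ℝ × ℝ, 1 + |z.1| < z.2 →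
        Bp k z.1 z.2 = ∑ i ∈ Finset.range N, a i z.2 * z.1 ^ i) →
      (∀ k, ∃ (N : ℕ) (a : ℕ → ℝ → ℝ), ∀ z : ℝ × ℝ, 1 + |z.1| < z.2 →
        Bv k z.1 z.2 = ∑ i ∈ Finset.range N, a i z.2 * z.1 ^ i) →
      (∀ k ∈ Finset.range (n / 2 + 1),
        Real.sqrt (∫ x in Ioi 1, (deriv (fun y => ι y ^ (n - 2 * k) - Bp k 0 y) x ^ 2
          + W x * (ι x ^ (n - 2 * k) - Bp k 0 x) ^ 2 + deriv (fun τ => Bp k τ x) 0 ^ 2))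
        ≤ δ₀ * Real.sqrt (∫ x in Ioi 1, (deriv (fun y => ι y ^ (n - 2 * k)) x ^ 2
          + W x * (ι x ^ (n - 2 * k)) ^ 2))) →
      (∀ k ∈ Finset.range ((n + 1) / 2),
        Real.sqrt (∫ x in Ioi 1, (deriv (Bv k 0) x ^ 2 + W x * Bv k 0 x ^ 2
          + (ι x ^ (n - 2 * k) - deriv (fun τ => Bv k τ x) 0) ^ 2))
        ≤ δ₀ * Real.sqrt (∫ x in Ioi 1, (ι x ^ (n - 2 * k)) ^ 2)) →
      ∃ (M : ℕ) (B : Fin M → ℝ → ℝ → ℝ), (∀ m, ContDiff ℝ 2 (Function.uncurry (B m))) ∧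
      (∀ m t x, 1 ≤ x →
        iteratedDeriv 2 (fun τ => B m τ x) t - iteratedDeriv 2 (B m t) x + W x * B m t x = 0) ∧
      (∀ m, IntegrableOn (fun x => deriv (fun τ => B m τ x) 0 ^ 2 + deriv (B m 0) x ^ 2
        + W x * B m 0 x ^ 2) (Ioi 1)) ∧
      (∀ m, Tendsto (fun t => ∫ x in Ioi (1 + |t|), (deriv (fun τ => B m τ x) t ^ 2
        + deriv (B m t) x ^ 2 + W x * B m t x ^ 2)) atTop (𝓝 0)) ∧
      (∀ m, Tendsto (fun t => ∫ x in Ioi (1 + |t|), (deriv (fun τ => B m τ x) t ^ 2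
        + deriv (B m t) x ^ 2 + W x * B m t x ^ 2)) atBot (𝓝 0)) ∧
      (∀ m, ∃ (N : ℕ) (a : ℕ → ℝ → ℝ), ∀ z : ℝ × ℝ, 1 + |z.1| < z.2 →
        B m z.1 z.2 = ∑ i ∈ Finset.range N, a i z.2 * z.1 ^ i) ∧
      (∀ (ch cg : ℕ → ℝ) (ε' : ℝ), 0 < ε' → ∃ c : Fin M → ℝ,
        Real.sqrt (∫ x in Ioi 1,
          (deriv (fun y => ladder ι n (fun z => ∑ m ∈ Finset.range (n + 1),
              ch m / m.factorial * (z - 1) ^ m) y - ∑ m, c m * B m 0 y) x ^ 2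
          + W x * (ladder ι n (fun z => ∑ m ∈ Finset.range (n + 1),
              ch m / m.factorial * (z - 1) ^ m) x - ∑ m, c m * B m 0 x) ^ 2
          + (ladder ι n (fun z => ∑ m ∈ Finset.range n, cg m / m.factorial * (z - 1) ^ m) x
              - ∑ m, c m * deriv (fun τ => B m τ x) 0) ^ 2))
        ≤ (1 / 2) * Real.sqrt (∫ x in Ioi 1,
          (deriv (ladder ι n (fun z => ∑ m ∈ Finset.range (n + 1),
              ch m / m.factorial * (z - 1) ^ m)) x ^ 2
          + W x * (ladder ι n (fun z => ∑ m ∈ Finset.range (n + 1),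
              ch m / m.factorial * (z - 1) ^ m) x) ^ 2
          + (ladder ι n (fun z => ∑ m ∈ Finset.range n, cg m / m.factorial * (z - 1) ^ m) x) ^ 2))
          + ε') := by
  classical
  obtain ⟨Λp, hΛp0, hΛp⟩ : ∃ Λ : ℝ, 0 ≤ Λ ∧ (1 ≤ n → ∀ α : ℕ → ℝ,
      IntegrableOn (fun x => deriv (fun y => ∑ k ∈ range (n / 2 + 1), α k * ι y ^ (n - 2 * k)) x ^ 2
        + (n : ℝ) * (n + 1) * ι x ^ 2
          * (∑ k ∈ range (n / 2 + 1), α k * ι x ^ (n - 2 * k)) ^ 2) (Ioi 1) ∧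
      ∑ k ∈ range (n / 2 + 1), |α k| ≤ Λ * Real.sqrt (∫ x in Ioi 1,
        (deriv (fun y => ∑ k ∈ range (n / 2 + 1), α k * ι y ^ (n - 2 * k)) x ^ 2
        + (n : ℝ) * (n + 1) * ι x ^ 2
          * (∑ k ∈ range (n / 2 + 1), α k * ι x ^ (n - 2 * k)) ^ 2))) := by
    rcases Nat.eq_zero_or_pos n with h | h
    · exact ⟨0, le_rfl, fun h1 => absurd h1 (by omega)⟩
    · obtain ⟨Λ, h0, hΛ⟩ := exists_coeffBound_position hι hιeq h
      exact ⟨Λ, h0, fun _ => hΛ⟩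
  obtain ⟨Λv, hΛv0, hΛv⟩ := exists_coeffBound_velocity hι hιeq (n := n)
  set κ : ℝ := (n : ℝ) ^ 2 + ((n : ℝ) * ((n : ℝ) + 1) + 1) with hκ
  have hκ0 : 0 ≤ κ := by positivity
  set I₂ : ℝ := ∫ x in Ioi (1 : ℝ), ι x ^ 2 with hI₂
  have hI₂0 : 0 ≤ I₂ := setIntegral_nonneg measurableSet_Ioi fun x _ => sq_nonneg _
  set nbar : ℝ := Real.sqrt (κ * I₂) with hnbar
  set mbar : ℝ := Real.sqrt I₂ with hmbar
  set C : ℝ := Real.sqrt 2 * nbar * Λp + mbar * Λv with hC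
  have hC0 : 0 ≤ C := by positivity
  have hδ₀0 : 0 < 1 / (2 * C + 2) := by positivity
  have hδ₀C : 1 / (2 * C + 2) * C ≤ 1 / 2 := by
    rw [div_mul_eq_mul_div, one_mul, div_le_iff₀ (by positivity)]; linarith
  have hδ₀le : 1 / (2 * C + 2) ≤ 1 / 2 :=
    one_div_le_one_div_of_le (by norm_num) (by linarith)
  refine ⟨1 / (2 * C + 2), hδ₀0, ?_⟩
  intro W hW hW0 ε hε0 hε hclose Bp Bv hBp hBv hresP hresV hintP hintV hradPT hradPB hradVT hradVB
    hpolyP hpolyV hcloseP hcloseV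
  set δ₀ : ℝ := 1 / (2 * C + 2) with hδ₀
  set mp : ℕ := n / 2 + 1 with hmp
  set mv : ℕ := (n + 1) / 2 with hmv
  obtain ⟨B, hBdef⟩ : ∃ B : Fin (mp + mv) → ℝ → ℝ → ℝ,
      ∀ i, B i = if (i : ℕ) < mp then Bp i else Bv ((i : ℕ) - mp) := ⟨_, fun i => rfl⟩
  have hBalt : ∀ i : Fin (mp + mv), B i = Bp i ∨ B i = Bv ((i : ℕ) - mp) := by
    intro i; rw [hBdef i]; split_ifs; exacts [Or.inl rfl, Or.inr rfl]
  refine ⟨mp + mv, B, fun i => ?_, fun i => ?_, fun i => ?_, fun i => ?_, fun i => ?_, fun i => ?_, ?_⟩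
  · rcases hBalt i with h | h <;> rw [h]; exacts [hBp _, hBv _]
  · rcases hBalt i with h | h <;> rw [h]; exacts [hresP _, hresV _]
  · rcases hBalt i with h | h <;> rw [h]; exacts [hintP _, hintV _]
  · rcases hBalt i with h | h <;> rw [h]; exacts [hradPT _, hradVT _]
  · rcases hBalt i with h | h <;> rw [h]; exacts [hradPB _, hradVB _]
  · rcases hBalt i with h | h <;> rw [h]; exacts [hpolyP _, hpolyV _]
  intro ch cg ε' hε'
  have hnbar0 : 0 ≤ nbar := Real.sqrt_nonneg _
  have hmbar0 : 0 ≤ mbar := Real.sqrt_nonneg _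
  obtain ⟨α, hα⟩ := exists_ladder_taylorSum_eq hι hιeq n (fun m => ch m / m.factorial) 1
  obtain ⟨β, hβ⟩ := exists_ladder_taylorSum_lt_eq hι hιeq n (fun m => cg m / m.factorial) 1
  have hWle : ∀ x, 1 ≤ x → W x ≤ ((n : ℝ) * (n + 1) + 1) * ι x ^ 2 := fun x hx =>
    nearInverseSquare_le_iota_sq hιeq hε0 hε hW0 hclose hx
  obtain ⟨hPC, hQc, iP1, iP2, iP3⟩ := ladderTaylor_admissible hι hιeq n hW hW0 hWle ch cg
  set P : ℝ → ℝ := ladder ι n (fun z => ∑ m ∈ Finset.range (n + 1), ch m / m.factorial * (z - 1) ^ m)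
    with hPdef
  set Q : ℝ → ℝ := ladder ι n (fun z => ∑ m ∈ Finset.range n, cg m / m.factorial * (z - 1) ^ m)
    with hQdef
  have hPeq : ∀ x, 1 / 2 < x → P x = ∑ k ∈ range mp, α k * ι x ^ (n - 2 * k) := fun x hx => hα x hx
  have hQeq : ∀ x, 1 / 2 < x → Q x = ∑ k ∈ range mv, β k * ι x ^ (n - 2 * k) := fun x hx => hβ x hx
  set NPQ : ℝ := Real.sqrt (∫ x in Ioi 1, (deriv P x ^ 2 + W x * P x ^ 2 + Q x ^ 2)) with hNPQ
  have hNPQ0 : 0 ≤ NPQ := Real.sqrt_nonneg _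
  obtain ⟨c, hcdef⟩ : ∃ c : Fin (mp + mv) → ℝ,
      ∀ i, c i = if (i : ℕ) < mp then α i else β ((i : ℕ) - mp) := ⟨_, fun i => rfl⟩
  refine ⟨c, ?_⟩
  have hsumB : ∀ y, ∑ i, c i * B i 0 y
      = ∑ k ∈ range mp, α k * Bp k 0 y + ∑ k ∈ range mv, β k * Bv k 0 y := by
    intro y
    rw [← sum_fin_glue mp mv (fun k => α k * Bp k 0 y) (fun k => β k * Bv k 0 y)]
    refine Finset.sum_congr rfl fun i _ => ?_
    rw [hBdef i, hcdef i]
    split_ifs <;> rfl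
  have hsumBt : ∀ x, ∑ i, c i * deriv (fun τ => B i τ x) 0
      = ∑ k ∈ range mp, α k * deriv (fun τ => Bp k τ x) 0
        + ∑ k ∈ range mv, β k * deriv (fun τ => Bv k τ x) 0 := by
    intro x
    rw [← sum_fin_glue mp mv (fun k => α k * deriv (fun τ => Bp k τ x) 0)
      (fun k => β k * deriv (fun τ => Bv k τ x) 0)]
    refine Finset.sum_congr rfl fun i _ => ?_
    rw [hBdef i, hcdef i]
    split_ifs <;> rfl
  have hslice : ∀ F : ℝ → ℝ → ℝ, ContDiff ℝ 2 (Function.uncurry F) → ContDiff ℝ 1 fun y => F 0 y :=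
    fun F hF => (hF.comp ((contDiff_const (c := (0 : ℝ))).prodMk contDiff_id)).of_le (by norm_num)
  have hιC1 : ∀ m : ℕ, ContDiff ℝ 1 (fun y => ι y ^ m) := fun m =>
    (hι.pow m).of_le (by exact_mod_cast le_top)
  have dι := fun m => integrableOn_deriv_iota_pow_sq hι hιeq m
  have wι := fun m => integrableOn_W_mul_iota_pow_sq hι hιeq hW hε0 hε hW0 hclose m
  have i0 : IntegrableOn (fun _ : ℝ => (0 : ℝ) ^ 2) (Ioi (1 : ℝ)) := by
    simp only [ne_eq, OfNat.ofNat_ne_zero, not_false_eq_true, zero_pow]; exact integrableOn_zero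
  have admP : ∀ k, ContDiff ℝ 1 (fun y => ι y ^ (n - 2 * k) - Bp k 0 y) ∧
      Continuous (fun x => 0 - deriv (fun τ => Bp k τ x) 0) ∧
      IntegrableOn (fun x => deriv (fun y => ι y ^ (n - 2 * k) - Bp k 0 y) x ^ 2) (Ioi 1) ∧
      IntegrableOn (fun x => W x * (ι x ^ (n - 2 * k) - Bp k 0 x) ^ 2) (Ioi 1) ∧
      IntegrableOn (fun x => (0 - deriv (fun τ => Bp k τ x) 0) ^ 2) (Ioi 1) := by
    intro k
    obtain ⟨c1, -, j1, j2, j3⟩ := farEnergy_pieces hW hW0 (hBp k) 0 (hintP k)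
    have hs := hslice _ (hBp k)
    refine ⟨(hιC1 _).sub hs, continuous_const.sub c1, ?_⟩
    exact energy_pieces_sub hW hW0 (hιC1 _) hs continuous_const c1 measurableSet_Ioi
      (dι _).1 (wι _).1 i0 j1 j2 j3
  have admV : ∀ k ∈ range mv, ContDiff ℝ 1 (fun y => 0 - Bv k 0 y) ∧
      Continuous (fun x => ι x ^ (n - 2 * k) - deriv (fun τ => Bv k τ x) 0) ∧
      IntegrableOn (fun x => deriv (fun y => 0 - Bv k 0 y) x ^ 2) (Ioi 1) ∧
      IntegrableOn (fun x => W x * (0 - Bv k 0 x) ^ 2) (Ioi 1) ∧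
      IntegrableOn (fun x => (ι x ^ (n - 2 * k) - deriv (fun τ => Bv k τ x) 0) ^ 2) (Ioi 1) := by
    intro k hk
    have hk' := Finset.mem_range.1 hk
    have hm : 1 ≤ n - 2 * k := by omega
    obtain ⟨c1, -, j1, j2, j3⟩ := farEnergy_pieces hW hW0 (hBv k) 0 (hintV k)
    have hs := hslice _ (hBv k)
    refine ⟨contDiff_const.sub hs, (hι.continuous.pow _).sub c1, ?_⟩
    have i1 : IntegrableOn (fun x => deriv (fun _ : ℝ => (0 : ℝ)) x ^ 2) (Ioi (1 : ℝ)) := by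
      simp only [deriv_const', ne_eq, OfNat.ofNat_ne_zero, not_false_eq_true, zero_pow]
      exact integrableOn_zero
    have i2 : IntegrableOn (fun x => W x * (0 : ℝ) ^ 2) (Ioi (1 : ℝ)) := by
      simp only [ne_eq, OfNat.ofNat_ne_zero, not_false_eq_true, zero_pow, mul_zero]
      exact integrableOn_zero
    exact energy_pieces_sub hW hW0 contDiff_const hs (hι.continuous.pow _) c1 measurableSet_Ioi
      i1 i2 (integrableOn_iota_pow_sq hι hιeq hm).1 j1 j2 j3
  obtain ⟨c1a, c2a, ja1, ja2, ja3, hlea⟩ := sqrt_energy_finset_sum_le hW hW0 (range mp)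
    (h := fun k y => ι y ^ (n - 2 * k) - Bp k 0 y) (g := fun k x => 0 - deriv (fun τ => Bp k τ x) 0)
    α measurableSet_Ioi (fun k _ => (admP k).1) (fun k _ => (admP k).2.1)
    (fun k _ => (admP k).2.2.1) (fun k _ => (admP k).2.2.2.1) (fun k _ => (admP k).2.2.2.2)
  obtain ⟨c1b, c2b, jb1, jb2, jb3, hleb⟩ := sqrt_energy_finset_sum_le hW hW0 (range mv)
    (h := fun k y => 0 - Bv k 0 y) (g := fun k x => ι x ^ (n - 2 * k) - deriv (fun τ => Bv k τ x) 0)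
    β measurableSet_Ioi (fun k hk => (admV k hk).1) (fun k hk => (admV k hk).2.1)
    (fun k hk => (admV k hk).2.2.1) (fun k hk => (admV k hk).2.2.2.1)
    (fun k hk => (admV k hk).2.2.2.2)
  obtain ⟨-, hadd⟩ := sqrt_energy_add_le hW hW0 c1a c1b c2a c2b measurableSet_Ioi
    ja1 ja2 ja3 jb1 jb2 jb3
  have hptP : ∀ y, 1 / 2 < y → P y - ∑ i, c i * B i 0 y
      = ∑ k ∈ range mp, α k * (ι y ^ (n - 2 * k) - Bp k 0 y)
        + ∑ k ∈ range mv, β k * (0 - Bv k 0 y) := by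
    intro y hy
    rw [hPeq y hy, hsumB y]
    simp only [mul_sub, zero_sub, Finset.sum_sub_distrib, Finset.sum_neg_distrib, mul_neg]
    ring
  have hptQ : ∀ x, 1 / 2 < x → Q x - ∑ i, c i * deriv (fun τ => B i τ x) 0
      = ∑ k ∈ range mp, α k * (0 - deriv (fun τ => Bp k τ x) 0)
        + ∑ k ∈ range mv, β k * (ι x ^ (n - 2 * k) - deriv (fun τ => Bv k τ x) 0) := by
    intro x hx
    rw [hQeq x hx, hsumBt x]
    simp only [mul_sub, zero_sub, Finset.sum_sub_distrib, Finset.sum_neg_distrib, mul_neg]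
    ring
  have hLHS : (∫ x in Ioi 1, (deriv (fun y => P y - ∑ i, c i * B i 0 y) x ^ 2
        + W x * (P x - ∑ i, c i * B i 0 x) ^ 2
        + (Q x - ∑ i, c i * deriv (fun τ => B i τ x) 0) ^ 2))
      = ∫ x in Ioi 1, (deriv (fun y => ∑ k ∈ range mp, α k * (ι y ^ (n - 2 * k) - Bp k 0 y)
            + ∑ k ∈ range mv, β k * (0 - Bv k 0 y)) x ^ 2
          + W x * (∑ k ∈ range mp, α k * (ι x ^ (n - 2 * k) - Bp k 0 x)
            + ∑ k ∈ range mv, β k * (0 - Bv k 0 x)) ^ 2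
          + (∑ k ∈ range mp, α k * (0 - deriv (fun τ => Bp k τ x) 0)
            + ∑ k ∈ range mv, β k * (ι x ^ (n - 2 * k) - deriv (fun τ => Bv k τ x) 0)) ^ 2) := by
    refine setIntegral_congr_fun measurableSet_Ioi fun x hx => ?_
    have hx1 : (1 : ℝ) < x := hx
    have hx' : (1 / 2 : ℝ) < x := by linarith
    have hev : (fun y => P y - ∑ i, c i * B i 0 y) =ᶠ[𝓝 x] fun y =>
        ∑ k ∈ range mp, α k * (ι y ^ (n - 2 * k) - Bp k 0 y)
          + ∑ k ∈ range mv, β k * (0 - Bv k 0 y) :=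
      Filter.mem_of_superset (Ioi_mem_nhds hx') fun y hy => hptP y hy
    rw [hev.deriv_eq, hptP x hx', hptQ x hx']
  have bndP : ∀ k ∈ range mp,
      Real.sqrt (∫ x in Ioi 1, (deriv (fun y => ι y ^ (n - 2 * k) - Bp k 0 y) x ^ 2
        + W x * (ι x ^ (n - 2 * k) - Bp k 0 x) ^ 2 + (0 - deriv (fun τ => Bp k τ x) 0) ^ 2))
      ≤ δ₀ * Real.sqrt (∫ x in Ioi 1, (deriv (fun y => ι y ^ (n - 2 * k)) x ^ 2
          + W x * (ι x ^ (n - 2 * k)) ^ 2)) := by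
    intro k hk
    have h := hcloseP k hk
    simpa only [zero_sub, neg_sq] using h
  have bndV : ∀ k ∈ range mv,
      Real.sqrt (∫ x in Ioi 1, (deriv (fun y => 0 - Bv k 0 y) x ^ 2 + W x * (0 - Bv k 0 x) ^ 2
        + (ι x ^ (n - 2 * k) - deriv (fun τ => Bv k τ x) 0) ^ 2))
      ≤ δ₀ * Real.sqrt (∫ x in Ioi 1, (ι x ^ (n - 2 * k)) ^ 2) := by
    intro k hk
    have h := hcloseV k hk
    simpa only [zero_sub, deriv.fun_neg, neg_sq] using h
  have refP : ∀ k ∈ range mp, Real.sqrt (∫ x in Ioi 1, (deriv (fun y => ι y ^ (n - 2 * k)) x ^ 2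
      + W x * (ι x ^ (n - 2 * k)) ^ 2)) ≤ nbar := by
    intro k _
    refine Real.sqrt_le_sqrt ?_
    have hint := ((dι (n - 2 * k)).1.add (wι (n - 2 * k)).1)
    calc (∫ x in Ioi 1, (deriv (fun y => ι y ^ (n - 2 * k)) x ^ 2 + W x * (ι x ^ (n - 2 * k)) ^ 2))
        ≤ ∫ x in Ioi 1, κ * ι x ^ 2 := by
          refine setIntegral_mono_on hint ((integrableOn_iota_pow hι hιeq le_rfl).const_mul κ)
            measurableSet_Ioi fun x hx => ?_
          have h1 := (dι (n - 2 * k)).2 x hx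
          have h2 := (wι (n - 2 * k)).2 x hx
          have hmn : ((n - 2 * k : ℕ) : ℝ) ^ 2 ≤ (n : ℝ) ^ 2 := by
            have : ((n - 2 * k : ℕ) : ℝ) ≤ n := by exact_mod_cast Nat.sub_le n (2 * k)
            exact pow_le_pow_left₀ (Nat.cast_nonneg _) this 2
          have hι2 : 0 ≤ ι x ^ 2 := sq_nonneg _
          have h3 := mul_le_mul_of_nonneg_right hmn hι2
          rw [hκ]
          linear_combination h1 + h2 + h3
      _ = κ * I₂ := by rw [integral_const_mul]
  have refV : ∀ k ∈ range mv, Real.sqrt (∫ x in Ioi 1, (ι x ^ (n - 2 * k)) ^ 2) ≤ mbar := by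
    intro k hk
    have hk' := Finset.mem_range.1 hk
    have hm : 1 ≤ n - 2 * k := by omega
    refine Real.sqrt_le_sqrt ?_
    obtain ⟨hint, hpt⟩ := integrableOn_iota_pow_sq hι hιeq hm
    exact setIntegral_mono_on hint (integrableOn_iota_pow hι hιeq le_rfl) measurableSet_Ioi
      fun x hx => hpt x hx
  have hRB : Real.sqrt (∫ x in Ioi 1, (∑ k ∈ range mv, β k * ι x ^ (n - 2 * k)) ^ 2) ≤ NPQ := by
    rw [hNPQ]
    refine Real.sqrt_le_sqrt (setIntegral_mono_on (hΛv β).1 ((iP1.add iP2).add iP3)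
      measurableSet_Ioi fun x hx => ?_)
    have hx1 : (1 : ℝ) < x := hx
    have hx' : (1 / 2 : ℝ) < x := by linarith
    rw [← hQeq x hx']
    show Q x ^ 2 ≤ deriv P x ^ 2 + W x * P x ^ 2 + Q x ^ 2
    have h4 : 0 ≤ deriv P x ^ 2 := sq_nonneg _
    have h5 : 0 ≤ W x * P x ^ 2 := mul_nonneg (hW0 x) (sq_nonneg _)
    linear_combination h4 + h5
  calc _ ≤ ∑ k ∈ range mp, |α k| * (δ₀ * Real.sqrt (∫ x in Ioi 1,
            (deriv (fun y => ι y ^ (n - 2 * k)) x ^ 2 + W x * (ι x ^ (n - 2 * k)) ^ 2)))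
          + (∑ k ∈ range mv, |β k|) * (δ₀ * mbar) := by
        rw [hLHS, Finset.sum_mul]
        refine hadd.trans (add_le_add (hlea.trans (Finset.sum_le_sum fun k hk => ?_))
          (hleb.trans (Finset.sum_le_sum fun k hk => ?_)))
        · exact mul_le_mul_of_nonneg_left (bndP k hk) (abs_nonneg _)
        · exact mul_le_mul_of_nonneg_left ((bndV k hk).trans
            (mul_le_mul_of_nonneg_left (refV k hk) hδ₀0.le)) (abs_nonneg _)
    _ ≤ 1 / 2 * NPQ := ?_
    _ ≤ 1 / 2 * NPQ + ε' := le_add_of_nonneg_right hε'.le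
  rcases Nat.eq_zero_or_pos n with hn0 | hn1
  · -- `n = 0`: one-dimensional exact data `(α₀, 0)`
    have hmp1 : mp = 1 := by rw [hmp, hn0]
    have hmv0 : mv = 0 := by rw [hmv, hn0]
    have hR0 : NPQ = |α 0| * Real.sqrt (∫ x in Ioi 1,
        (deriv (fun y => ι y ^ (n - 2 * 0)) x ^ 2 + W x * (ι x ^ (n - 2 * 0)) ^ 2)) := by
      rw [hNPQ, ← Real.sqrt_sq_eq_abs, ← Real.sqrt_mul (sq_nonneg _), ← integral_const_mul]
      congr 1
      refine setIntegral_congr_fun measurableSet_Ioi fun x hx => ?_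
      have hx1 : (1 : ℝ) < x := hx
      have hx' : (1 / 2 : ℝ) < x := by linarith
      have hP0 : ∀ y, 1 / 2 < y → P y = α 0 * ι y ^ (n - 2 * 0) := by
        intro y hy; rw [hPeq y hy, hmp1, Finset.sum_range_one]
      have hQ0 : Q x = 0 := by rw [hQeq x hx', hmv0, Finset.sum_range_zero]
      have hev : P =ᶠ[𝓝 x] fun y => α 0 * ι y ^ (n - 2 * 0) :=
        Filter.mem_of_superset (Ioi_mem_nhds hx') fun y hy => hP0 y hy
      rw [hev.deriv_eq, hP0 x hx', hQ0, deriv_const_mul _ ((hι.pow _).differentiable (by simp) x)]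
      ring
    have hβ0 : ∑ k ∈ range mv, |β k| = 0 := by rw [hmv0, Finset.sum_range_zero]
    rw [hβ0, zero_mul, add_zero, hmp1, Finset.sum_range_one, hR0]
    have hR0' : 0 ≤ Real.sqrt (∫ x in Ioi 1,
        (deriv (fun y => ι y ^ (n - 2 * 0)) x ^ 2 + W x * (ι x ^ (n - 2 * 0)) ^ 2)) :=
      Real.sqrt_nonneg _
    have hα0 : 0 ≤ |α 0| := abs_nonneg _
    calc |α 0| * (δ₀ * Real.sqrt (∫ x in Ioi 1,
          (deriv (fun y => ι y ^ (n - 2 * 0)) x ^ 2 + W x * (ι x ^ (n - 2 * 0)) ^ 2)))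
        = δ₀ * (|α 0| * Real.sqrt (∫ x in Ioi 1,
          (deriv (fun y => ι y ^ (n - 2 * 0)) x ^ 2 + W x * (ι x ^ (n - 2 * 0)) ^ 2))) := by ring
      _ ≤ 1 / 2 * (|α 0| * Real.sqrt (∫ x in Ioi 1,
          (deriv (fun y => ι y ^ (n - 2 * 0)) x ^ 2 + W x * (ι x ^ (n - 2 * 0)) ^ 2))) :=
        mul_le_mul_of_nonneg_right hδ₀le (mul_nonneg hα0 hR0')
  · -- `1 ≤ n`
    have hαsum := (hΛp hn1 α).2
    have hβsum := (hΛv β).2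
    have hRA : Real.sqrt (∫ x in Ioi 1,
        (deriv (fun y => ∑ k ∈ range mp, α k * ι y ^ (n - 2 * k)) x ^ 2
        + (n : ℝ) * (n + 1) * ι x ^ 2 * (∑ k ∈ range mp, α k * ι x ^ (n - 2 * k)) ^ 2))
        ≤ Real.sqrt 2 * NPQ := by
      rw [hNPQ, ← Real.sqrt_mul (by norm_num : (0 : ℝ) ≤ 2), ← integral_const_mul]
      refine Real.sqrt_le_sqrt (setIntegral_mono_on (hΛp hn1 α).1
        (((iP1.add iP2).add iP3).const_mul 2) measurableSet_Ioi fun x hx => ?_)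
      have hx1 : (1 : ℝ) < x := hx
      have hx' : (1 / 2 : ℝ) < x := by linarith
      have hev : (fun y => ∑ k ∈ range mp, α k * ι y ^ (n - 2 * k)) =ᶠ[𝓝 x] P :=
        Filter.mem_of_superset (Ioi_mem_nhds hx') fun y hy => (hPeq y hy).symm
      rw [hev.deriv_eq, ← hPeq x hx']
      show deriv P x ^ 2 + (n : ℝ) * (n + 1) * ι x ^ 2 * P x ^ 2
        ≤ 2 * (deriv P x ^ 2 + W x * P x ^ 2 + Q x ^ 2)
      obtain ⟨h2W, -, -, -⟩ := nearInverseSquare_pointwise hε0 hε hW0 hclose hx1.le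
      have hιx : (n : ℝ) * (n + 1) * ι x ^ 2 = (n : ℝ) * ((n : ℝ) + 1) / x ^ 2 := by
        rw [hιeq x hx'.le, inv_pow, div_eq_mul_inv]
      rw [hιx]
      have h3 : (n : ℝ) * ((n : ℝ) + 1) / x ^ 2 * P x ^ 2 ≤ 2 * W x * P x ^ 2 :=
        mul_le_mul_of_nonneg_right h2W (sq_nonneg _)
      have h4 : 0 ≤ deriv P x ^ 2 := sq_nonneg _
      have h5 : 0 ≤ Q x ^ 2 := sq_nonneg _
      linear_combination h3 + h4 + 2 * h5
    have hfirst : ∑ k ∈ range mp, |α k| * (δ₀ * Real.sqrt (∫ x in Ioi 1,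
          (deriv (fun y => ι y ^ (n - 2 * k)) x ^ 2 + W x * (ι x ^ (n - 2 * k)) ^ 2)))
        ≤ (∑ k ∈ range mp, |α k|) * (δ₀ * nbar) := by
      rw [Finset.sum_mul]
      exact Finset.sum_le_sum fun k hk => mul_le_mul_of_nonneg_left
        (mul_le_mul_of_nonneg_left (refP k hk) hδ₀0.le) (abs_nonneg _)
    calc _ ≤ (∑ k ∈ range mp, |α k|) * (δ₀ * nbar) + (∑ k ∈ range mv, |β k|) * (δ₀ * mbar) :=
          add_le_add hfirst le_rfl
      _ ≤ (Λp * (Real.sqrt 2 * NPQ)) * (δ₀ * nbar) + (Λv * NPQ) * (δ₀ * mbar) :=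
          add_le_add (mul_le_mul_of_nonneg_right (hαsum.trans (mul_le_mul_of_nonneg_left hRA hΛp0))
            (mul_nonneg hδ₀0.le hnbar0))
            (mul_le_mul_of_nonneg_right (hβsum.trans (mul_le_mul_of_nonneg_left hRB hΛv0))
            (mul_nonneg hδ₀0.le hmbar0))
      _ = (δ₀ * C) * NPQ := by rw [hC]; ring
      _ ≤ 1 / 2 * NPQ := mul_le_mul_of_nonneg_right hδ₀C hNPQ0

end Literature.Analysis.PDE
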